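import Mathlib
import HarnessLib.Audit
import Summits.PneNP.PneNP.Theorems.PstarNorDataCounts
import Summits.PneNP.PneNP.Theorems.PstarNorDataTriangle
import Summits.PneNP.PneNP.Theorems.PstarLitGateCore

/-!
# Proof of the pin + gate core accounting lemma `LitGateCoreBound` (ROUND-24, GAPTWO-PLAN v1.1 S4c′)

FRONTIER range-avoidance ladder, rung F-N3, ROUND 24 (cell `pnp-ideate`, planner memo `CORE-BOUND-NOTES.md` §10.1–10.2; restricted-model
proof complexity — nothing here bears on `P` versus `NP`).

`litGateCoreBound : PstarLitGateCore.LitGateCoreBound` — in fact `card_le_three`: an XOR-closed `J₀` with a pin + gate structure has at most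
THREE outputs.  (1) `lambda_holder`: a certified chord `e` has a shortest `(σ, Λ e)`-literal path of length `≥ 2` (length `1` would be `e`,
simple overlaps) whose first two edges share an XOR variable, so one of them — an output of `J₀ ∖ N` — holds `Λ e`.  (2) `global_count`
(memo (ACC), exact) on `𝓕 = J₀ ∪ ρ(N)`: readers keep their two tips, chords one private, literal edges their fourth variable, plus `σ` for
at most one `σ`-edge: `#(J₀ ∖ N) ≤ 2b`, `b ≤ 1` the number of literal edges holding `σ` privately in `𝓕`.  (3) `card_le_three`: `b = 0`
leaves no literal edge hence no chord; `b = 1` forbids `σ`-chords, so every literal path runs inside the `≤ 2` literal edges, has length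
exactly `2`, and all certified chords share the XOR pair `ends (J₀ ∖ N)` — at most one chord.
-/

set_option linter.dupNamespace false

open Finset Literature.Computability.Complexity
open Summit.PneNP.PneNP.Theorems.PstarSALevel (varSet bdry BoundaryExpanding SimpleOverlap)
open Summit.PneNP.PneNP.Theorems.PstarGapLinearised (andPair andPair_subset_varSet)
open Summit.PneNP.PneNP.Theorems.PstarChordRepair (IsChord)
open Summit.PneNP.PneNP.Theorems.PstarCentreFree (vars_mem_varSet)
open Summit.PneNP.PneNP.Theorems.PstarGapOneKills (mem_andPair_of_slot)
open Summit.PneNP.PneNP.Theorems.PstarChordEndgameTools (not_two_shared mem_andPair_iff)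
open Summit.PneNP.PneNP.Theorems.PstarCoreBound (XorClosed)
open Summit.PneNP.PneNP.Theorems.PstarLitNorCore (LitEdge LitAdj)
open Summit.PneNP.PneNP.Theorems.PstarLitGateCore (GateReader LitGateStructure LitGateCoreBound)
open Summit.PneNP.PneNP.Theorems.PstarNorCoreTools (not_mem_bdry_of_two card_varSet_inter_bdry_le card_bdry_le_sum xorPair
  mem_xorPair_iff xorPair_subset_varSet vars_zero_ne_one card_xorPair not_mem_andPair_of_mem_xorPair ne_of_xorPair_eq)
open Summit.PneNP.PneNP.Theorems.PstarNorDataTools (CAdj)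
open Summit.PneNP.PneNP.Theorems.PstarNorDataCounts (xor_not_mem_bdry)
open Summit.PneNP.PneNP.Theorems.PstarNorDataTriangle (cg exists_cen_of_adj reachable_of_reflTransGen)

namespace Summit.PneNP.PneNP.Theorems.PstarLitGateCoreProof

variable {n m : ℕ}

/-- A literal edge holds one of its literals in its AND pair. -/
theorem mem_andPair_of_litEdge (I : LocalMap 4 n m) {σ τ : Fin n} {f : Fin m} (h : LitEdge I σ τ f) :
    σ ∈ andPair I f ∨ τ ∈ andPair I f := by
  rcases h with h | h | h | h
  · exact Or.inl (h ▸ mem_andPair_of_slot I f 2 (by decide))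
  · exact Or.inr (h ▸ mem_andPair_of_slot I f 2 (by decide))
  · exact Or.inl (h ▸ mem_andPair_of_slot I f 3 (by decide))
  · exact Or.inr (h ▸ mem_andPair_of_slot I f 3 (by decide))

/-- In a pin + gate structure no certified chord holds a gate literal in its AND pair. -/
theorem lambda_not_mem {I : LocalMap 4 n m} {J₀ N : Finset (Fin m)} {σ : Fin n} {Λ : Fin m → Fin n} {ρ : Fin m → Fin m}
    (hG : LitGateStructure I J₀ N σ Λ ρ) {e g : Fin m} (he : e ∈ N) (hg : g ∈ N) : Λ e ∉ andPair I g := by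
  intro hmem
  obtain ⟨-, -, -, -, hΛ, -⟩ := hG.2.1 e he
  rw [mem_andPair_iff] at hmem
  rcases hmem with h | h
  · exact (hΛ g hg).1 h
  · exact (hΛ g hg).2 h

/-- Slot bookkeeping: `{0, 1, s}` has three elements for an AND slot `s`. -/
theorem card_three_slots (s : Fin 4) (hs : 2 ≤ s.val) : ({0, 1, s} : Finset (Fin 4)).card = 3 := by
  have h0 : (0 : Fin 4) ≠ s := fun h => by rw [← h] at hs; exact absurd hs (by decide)
  have h1 : (1 : Fin 4) ≠ s := fun h => by rw [← h] at hs; exact absurd hs (by decide)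
  rw [card_insert_of_notMem, card_pair h1]
  simp only [mem_insert, mem_singleton, not_or]
  exact ⟨by decide, h0⟩

/-- The ENDS of a two-edge set `C`: the XOR variables lying on exactly one member of `C`. -/
def ends (I : LocalMap 4 n m) (C : Finset (Fin m)) : Finset (Fin n) :=
  (C.biUnion (xorPair I)).filter fun v => (C.filter fun g => v ∈ xorPair I g).card = 1

/-- For `C = {g₁, g₂}` with XOR pairs `{a, v}`, `{v, b}` (`a, v, b` distinct) the ends are `{a, b}`. -/
theorem ends_eq (I : LocalMap 4 n m) {C : Finset (Fin m)} {g₁ g₂ : Fin m} {a v b : Fin n} (hC : C = {g₁, g₂}) (hne : g₁ ≠ g₂)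
    (h₁ : xorPair I g₁ = {a, v}) (h₂ : xorPair I g₂ = {v, b}) (hav : a ≠ v) (hvb : v ≠ b) (hab : a ≠ b) :
    ends I C = {a, b} := by
  classical
  subst hC
  ext w
  simp only [ends, mem_filter, mem_biUnion, mem_insert, mem_singleton, exists_eq_or_imp, exists_eq_left, h₁, h₂,
    filter_insert, filter_singleton]
  constructor
  · rintro ⟨hw, hcard⟩
    rcases hw with (rfl | rfl) | (rfl | rfl)
    · exact Or.inl rfl
    · exfalso
      rw [if_pos (Or.inr rfl), if_pos (Or.inl rfl), card_insert_of_notMem (by simpa using hne), card_singleton] at hcard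
      exact absurd hcard (by decide)
    · exfalso
      rw [if_pos (Or.inr rfl), if_pos (Or.inl rfl), card_insert_of_notMem (by simpa using hne), card_singleton] at hcard
      exact absurd hcard (by decide)
    · exact Or.inr rfl
  · rintro (rfl | rfl)
    · refine ⟨Or.inl (Or.inl rfl), ?_⟩
      rw [if_pos (Or.inl rfl), if_neg (by rintro (h | h); exacts [hav h, hab h])]
      simp
    · refine ⟨Or.inr (Or.inr rfl), ?_⟩
      rw [if_neg (by rintro (h | h); exacts [hab h.symm, hvb h.symm]), if_pos (Or.inr rfl), card_singleton]

section Gate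

variable {I : LocalMap 4 n m} (hI : I.IsPure xorAndPred) (hS : SimpleOverlap I) {r : ℕ} (hB : BoundaryExpanding r I)
variable {J₀ N : Finset (Fin m)} {σ : Fin n} {Λ : Fin m → Fin n} {ρ : Fin m → Fin m}
variable (hk : (J₀ ∪ N.image ρ).card ≤ r) (hx : XorClosed I J₀) (hG : LitGateStructure I J₀ N σ Λ ρ)

include hI hS hG in
/-- **Literal paths.**  A certified chord `e` has a shortest path of `(σ, Λ e)`-literal edges of `J₀` joining its XOR pair: length `ℓ ≥ 2`,
edges `f i` with XOR pairs `{v_i, v_{i+1}}`, vertices and edges pairwise distinct. -/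
theorem path_data {e : Fin m} (he : e ∈ N) : ∃ ℓ : ℕ, 2 ≤ ℓ ∧ ∃ (f : ℕ → Fin m) (vtx : ℕ → Fin n),
    (∀ i < ℓ, f i ∈ J₀ ∧ LitEdge I σ (Λ e) (f i) ∧ xorPair I (f i) = {vtx i, vtx (i + 1)}) ∧ vtx 0 = I.vars e 0 ∧ vtx ℓ = I.vars e 1 ∧
    (∀ i ≤ ℓ, ∀ j ≤ ℓ, vtx i = vtx j → i = j) ∧ (∀ i < ℓ, ∀ j < ℓ, f i = f j → i = j) := by
  classical
  obtain ⟨-, hch, -⟩ := hG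
  obtain ⟨-, -, hnl, -, -, hpath⟩ := hch e he
  set C := J₀.filter (LitEdge I σ (Λ e)) with hC
  have hle : ∀ v v', LitAdj I J₀ σ (Λ e) v v' → CAdj I C v v' :=
    fun v v' ⟨f, hf, hl, hvv'⟩ => ⟨f, mem_filter.2 ⟨hf, hl⟩, hvv'⟩
  obtain ⟨p⟩ := reachable_of_reflTransGen I C (Relation.ReflTransGen.mono hle _ _ hpath)
  set q := p.bypass with hq
  have hqp : q.IsPath := p.bypass_isPath
  set ℓ := q.length with hℓ
  have hinj : ∀ i ≤ ℓ, ∀ j ≤ ℓ, q.getVert i = q.getVert j → i = j :=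
    fun i hi j hj h => hqp.getVert_injOn (by simpa using hi) (by simpa using hj) h
  have hv0 : q.getVert 0 = I.vars e 0 := q.getVert_zero
  have hvℓ : q.getVert ℓ = I.vars e 1 := q.getVert_length
  have hchoose : ∀ i, i < ℓ → ∃ f ∈ C, xorPair I f = {q.getVert i, q.getVert (i + 1)} :=
    fun i hi => exists_cen_of_adj I C (q.adj_getVert_succ hi)
  haveI : Nonempty (Fin m) := ⟨e⟩
  choose! f hf using hchoose
  have hfinj : ∀ i < ℓ, ∀ j < ℓ, f i = f j → i = j := by
    intro i hi j hj hij
    have hxe : ({q.getVert i, q.getVert (i + 1)} : Finset (Fin n)) = {q.getVert j, q.getVert (j + 1)} := by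
      rw [← (hf i hi).2, ← (hf j hj).2, hij]
    have h1 : q.getVert i ∈ ({q.getVert j, q.getVert (j + 1)} : Finset (Fin n)) := hxe ▸ mem_insert_self _ _
    have h2 : q.getVert j ∈ ({q.getVert i, q.getVert (i + 1)} : Finset (Fin n)) := hxe.symm ▸ mem_insert_self _ _
    rw [mem_insert, mem_singleton] at h1 h2
    rcases h1 with h1 | h1
    · exact hinj i hi.le j hj.le h1
    rcases h2 with h2 | h2
    · exact (hinj j hj.le i hi.le h2).symm
    have := hinj i hi.le (j + 1) hj h1
    have := hinj j hj.le (i + 1) hi h2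
    omega
  have hℓ0 : ℓ ≠ 0 := by
    intro h0
    have h := hvℓ; rw [h0] at h; exact vars_zero_ne_one I hI e (hv0.symm.trans h)
  have hℓ1 : ℓ ≠ 1 := by
    intro h1
    obtain ⟨hf0, hx0⟩ := hf 0 (by omega)
    rw [hv0, zero_add, ← h1, hvℓ] at hx0
    have : f 0 = e := ne_of_xorPair_eq I hI hS (by rw [hx0]; rfl)
    exact hnl (this ▸ (mem_filter.1 hf0).2)
  refine ⟨ℓ, by omega, f, q.getVert, fun i hi => ?_, hv0, hvℓ, hinj, hfinj⟩
  obtain ⟨hfC, hfx⟩ := hf i hi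
  exact ⟨(mem_filter.1 hfC).1, (mem_filter.1 hfC).2, hfx⟩

include hI hS hG in
/-- **Some literal edge of `J₀ ∖ N` holds `Λ e`** (the first two path edges share an XOR variable, so they are not both `σ`-edges, and no
certified chord holds a gate literal). -/
theorem lambda_holder {e : Fin m} (he : e ∈ N) : ∃ f ∈ J₀ \ N, Λ e ∈ andPair I f := by
  classical
  obtain ⟨ℓ, hℓ2, f, vtx, hf, -, -, -, hfinj⟩ := path_data hI hS hG he
  have noΛ : ∀ g ∈ N, Λ e ∉ andPair I g := fun g hg => lambda_not_mem hG he hg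
  obtain ⟨hf0, hl0, hx0⟩ := hf 0 (by omega)
  obtain ⟨hf1, hl1, hx1⟩ := hf 1 (by omega)
  have hne : f 0 ≠ f 1 := fun h => by have := hfinj 0 (by omega) 1 (by omega) h; omega
  have hv0 : vtx 1 ∈ xorPair I (f 0) := by rw [hx0]; exact mem_insert_of_mem (mem_singleton_self _)
  have hv1 : vtx 1 ∈ xorPair I (f 1) := by rw [hx1]; exact mem_insert_self _ _
  rcases mem_andPair_of_litEdge I hl0 with h0 | h0
  · rcases mem_andPair_of_litEdge I hl1 with h1 | h1
    · -- both hold `σ`: they share `σ` and `vtx 1`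
      exfalso
      exact not_two_shared I hS hne (not_mem_andPair_of_mem_xorPair I hI (f 0) hv0 |> fun h => fun heq => h (heq ▸ h0))
        (xorPair_subset_varSet I _ hv0) (xorPair_subset_varSet I _ hv1) (andPair_subset_varSet I _ h0) (andPair_subset_varSet I _ h1)
    · exact ⟨f 1, mem_sdiff.2 ⟨hf1, fun hn => noΛ _ hn h1⟩, h1⟩
  · exact ⟨f 0, mem_sdiff.2 ⟨hf0, fun hn => noΛ _ hn h0⟩, h0⟩

include hG hx hk hB hI hS in
/-- **Global count** on the family `𝓕 = J₀ ∪ ρ(N)`: `#(J₀ ∖ N) ≤ 2·b`, where `b ≤ 1` is the number of literal edges of `J₀ ∖ N` holding `σ`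
privately in `𝓕`. -/
theorem global_count : (J₀ \ N).card ≤
    2 * ((J₀ \ N).filter fun f => σ ∈ andPair I f ∧ σ ∈ bdry I (J₀ ∪ N.image ρ)).card := by
  classical
  obtain ⟨hNJ, hch, hcen⟩ := hG
  set F := J₀ ∪ N.image ρ with hF
  set R := N.image ρ with hR
  have hρ : ∀ e ∈ N, ρ e ∉ J₀ := fun e he => (hch e he).2.2.2.1.1
  have hdisj : Disjoint J₀ R := disjoint_right.2 fun g hg => by
    obtain ⟨e, he, rfl⟩ := mem_image.1 hg; exact hρ e he
  have hJF : J₀ ⊆ F := subset_union_left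
  have hRF : R ⊆ F := subset_union_right
  have hexp := hB F hk
  let ind : Fin m → ℕ := fun f => if σ ∈ andPair I f ∧ σ ∈ bdry I F then 1 else 0
  let qb : Fin m → ℕ := fun j => if j ∈ J₀ then (if j ∈ N then 1 else 1 + ind j) else 2
  have hq : ∀ j ∈ F, (varSet I j ∩ bdry I F).card ≤ qb j := by
    intro j hj
    by_cases hjJ : j ∈ J₀
    · simp only [qb, if_pos hjJ]
      by_cases hjN : j ∈ N
      · -- a certified chord: XOR slots and the read private
        rw [if_pos hjN]
        obtain ⟨-, -, -, ⟨hρJ, hread⟩, -, -⟩ := hch j hjN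
        have hρF : ρ j ∈ F := hRF (mem_image.2 ⟨j, hjN, rfl⟩)
        have hne : j ≠ ρ j := fun h => hρJ (h ▸ hjJ)
        obtain ⟨s, hs2, hsv⟩ : ∃ s : Fin 4, 2 ≤ s.val ∧ I.vars j s ∈ varSet I (ρ j) := by
          rcases hread with ⟨-, h | h⟩ | ⟨-, h | h⟩
          · exact ⟨2, by decide, h ▸ vars_mem_varSet I (ρ j) 3⟩
          · exact ⟨3, by decide, h ▸ vars_mem_varSet I (ρ j) 3⟩
          · exact ⟨2, by decide, h ▸ vars_mem_varSet I (ρ j) 2⟩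
          · exact ⟨3, by decide, h ▸ vars_mem_varSet I (ρ j) 2⟩
        have := card_varSet_inter_bdry_le I F j {0, 1, s} fun t ht => by
          simp only [mem_insert, mem_singleton] at ht
          rcases ht with rfl | rfl | rfl
          · exact xor_not_mem_bdry hx hJF hjJ 0 (by decide)
          · exact xor_not_mem_bdry hx hJF hjJ 1 (by decide)
          · exact not_mem_bdry_of_two I (hJF hjJ) hρF hne (vars_mem_varSet I j t) hsv
        rw [card_three_slots s hs2] at this
        simpa using this
      · -- a literal edge
        rw [if_neg hjN]
        by_cases hind : σ ∈ andPair I j ∧ σ ∈ bdry I F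
        · simp only [ind, if_pos hind]
          have := card_varSet_inter_bdry_le I F j {0, 1} fun t ht => by
            rw [mem_insert, mem_singleton] at ht
            rcases ht with rfl | rfl
            · exact xor_not_mem_bdry hx hJF hjJ 0 (by decide)
            · exact xor_not_mem_bdry hx hJF hjJ 1 (by decide)
          simpa using this
        · simp only [ind, if_neg hind, add_zero]
          -- the literal slot is non-private
          obtain ⟨s, hs2, hsb⟩ : ∃ s : Fin 4, 2 ≤ s.val ∧ I.vars j s ∉ bdry I F := by
            rcases hcen j (mem_sdiff.2 ⟨hjJ, hjN⟩) with hσ | ⟨e, he, hΛ⟩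
            · have hσa : σ ∈ andPair I j := by
                rcases hσ with h | h
                · exact h ▸ mem_andPair_of_slot I j 2 (by decide)
                · exact h ▸ mem_andPair_of_slot I j 3 (by decide)
              have hσb : σ ∉ bdry I F := fun h => hind ⟨hσa, h⟩
              rcases hσ with h | h
              · exact ⟨2, by decide, h ▸ hσb⟩
              · exact ⟨3, by decide, h ▸ hσb⟩
            · obtain ⟨-, -, -, ⟨hρJ, hread⟩, -, -⟩ := hch e he
              have hρF : ρ e ∈ F := hRF (mem_image.2 ⟨e, he, rfl⟩)
              have hne : j ≠ ρ e := fun h => hρJ (h ▸ hjJ)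
              have hΛρ : Λ e ∈ varSet I (ρ e) := by
                rcases hread with ⟨h, -⟩ | ⟨h, -⟩
                · exact h ▸ vars_mem_varSet I (ρ e) 2
                · exact h ▸ vars_mem_varSet I (ρ e) 3
              rcases hΛ with h | h
              · exact ⟨2, by decide, h ▸ not_mem_bdry_of_two I (hJF hjJ) hρF hne (h ▸ vars_mem_varSet I j 2) hΛρ⟩
              · exact ⟨3, by decide, h ▸ not_mem_bdry_of_two I (hJF hjJ) hρF hne (h ▸ vars_mem_varSet I j 3) hΛρ⟩
          have := card_varSet_inter_bdry_le I F j {0, 1, s} fun t ht => by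
            simp only [mem_insert, mem_singleton] at ht
            rcases ht with rfl | rfl | rfl
            · exact xor_not_mem_bdry hx hJF hjJ 0 (by decide)
            · exact xor_not_mem_bdry hx hJF hjJ 1 (by decide)
            · exact hsb
          rw [card_three_slots s hs2] at this
          simpa using this
    · -- a gate reader
      simp only [qb, if_neg hjJ]
      have hjR : j ∈ R := (mem_union.1 hj).resolve_left hjJ
      obtain ⟨e, he, rfl⟩ := mem_image.1 hjR
      obtain ⟨-, -, -, ⟨-, hread⟩, -, -⟩ := hch e he
      obtain ⟨fΛ, hfΛ, hΛf⟩ := lambda_holder hI hS ⟨hNJ, hch, hcen⟩ he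
      have hfΛJ : fΛ ∈ J₀ := (mem_sdiff.1 hfΛ).1
      have hne1 : ρ e ≠ fΛ := fun h => hjJ (by rw [h]; exact hfΛJ)
      have hne2 : ρ e ≠ e := fun h => hjJ (by rw [h]; exact hNJ he)
      have heF : e ∈ F := hJF (hNJ he)
      have key : ∀ (sl sp : Fin 4), I.vars (ρ e) sl = Λ e → (I.vars (ρ e) sp = I.vars e 2 ∨ I.vars (ρ e) sp = I.vars e 3) → sl ≠ sp →
          (varSet I (ρ e) ∩ bdry I F).card ≤ 2 := by
        intro sl sp hl hp hlp
        have := card_varSet_inter_bdry_le I F (ρ e) {sl, sp} fun t ht => by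
          rw [mem_insert, mem_singleton] at ht
          rcases ht with rfl | rfl
          · rw [hl]; exact not_mem_bdry_of_two I hj (hJF hfΛJ) hne1 (hl ▸ vars_mem_varSet I (ρ e) t) (andPair_subset_varSet I fΛ hΛf)
          · rcases hp with h | h
            · rw [h]; exact not_mem_bdry_of_two I hj heF hne2 (h ▸ vars_mem_varSet I (ρ e) t) (vars_mem_varSet I e 2)
            · rw [h]; exact not_mem_bdry_of_two I hj heF hne2 (h ▸ vars_mem_varSet I (ρ e) t) (vars_mem_varSet I e 3)
        rwa [card_pair hlp] at this
      rcases hread with ⟨hl, hp⟩ | ⟨hl, hp⟩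
      · exact key 2 3 hl hp (by decide)
      · exact key 3 2 hl hp (by decide)
  have hsum := card_bdry_le_sum I F qb hq
  -- the sum of the bounds
  have hb : ∑ j ∈ F, qb j = (N.card + ((J₀ \ N).card + ((J₀ \ N).filter fun f => σ ∈ andPair I f ∧ σ ∈ bdry I F).card)) +
      2 * R.card := by
    rw [hF, sum_union hdisj]
    congr 1
    · rw [← sum_sdiff hNJ, add_comm]
      congr 1
      · refine (sum_congr rfl fun j hj => ?_).trans (by rw [sum_const, smul_eq_mul, mul_one])
        simp only [qb, if_pos (hNJ hj), if_pos hj]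
      · rw [card_filter, card_eq_sum_ones, ← sum_add_distrib]
        refine sum_congr rfl fun j hj => ?_
        obtain ⟨hjJ, hjN⟩ := mem_sdiff.1 hj
        simp only [qb, ind, if_pos hjJ, if_neg hjN]
        rfl
    · refine (sum_congr rfl fun j hj => ?_).trans (by rw [sum_const, smul_eq_mul, mul_comm])
      obtain ⟨e, he, rfl⟩ := mem_image.1 hj
      simp only [qb, if_neg (hρ e he)]
  have hFcard : F.card = J₀.card + R.card := by rw [hF, card_union_of_disjoint hdisj]
  have hsplit : (J₀ \ N).card + N.card = J₀.card := card_sdiff_add_card_eq_card hNJ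
  have hRN : R.card ≤ N.card := card_image_le
  rw [hb] at hsum
  rw [hFcard] at hexp
  omega

omit hI hS hB hk hx hG in
/-- At most one literal edge holds `σ` privately. -/
theorem card_sigma_private_le_one (I : LocalMap 4 n m) (J₀ N : Finset (Fin m)) (σ : Fin n) (ρ : Fin m → Fin m) :
    ((J₀ \ N).filter fun f => σ ∈ andPair I f ∧ σ ∈ bdry I (J₀ ∪ N.image ρ)).card ≤ 1 := by
  classical
  refine card_le_one.2 fun f hf f' hf' => ?_
  rw [mem_filter] at hf hf'
  by_contra hne
  exact not_mem_bdry_of_two I (subset_union_left (mem_sdiff.1 hf.1).1) (subset_union_left (mem_sdiff.1 hf'.1).1) hne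
    (andPair_subset_varSet I f hf.2.1) (andPair_subset_varSet I f' hf'.2.1) hf.2.2

include hI hS hB hk hx hG in
/-- **The pin + gate core has at most three outputs.** -/
theorem card_le_three : J₀.card ≤ 3 := by
  classical
  have hgc := global_count hI hS hB hk hx hG
  have hb1 := card_sigma_private_le_one I J₀ N σ ρ
  obtain ⟨hNJ, hch, hcen⟩ := id hG
  have hsplit : (J₀ \ N).card + N.card = J₀.card := card_sdiff_add_card_eq_card hNJ
  set B := (J₀ \ N).filter fun f => σ ∈ andPair I f ∧ σ ∈ bdry I (J₀ ∪ N.image ρ) with hBdef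
  by_cases hb0 : B.card = 0
  · -- no literal edge at all, hence no certified chord
    have hc0 : (J₀ \ N).card = 0 := by omega
    have hN0 : N.card = 0 := by
      rw [card_eq_zero] at hc0 ⊢
      by_contra hne
      obtain ⟨e, he⟩ := nonempty_iff_ne_empty.2 hne
      obtain ⟨f, hf, -⟩ := lambda_holder hI hS hG he
      rw [hc0] at hf
      exact notMem_empty f hf
    omega
  · -- one `σ`-edge holds `σ` privately: literal paths run inside the ≤ 2 literal edges
    have hB1 : B.card = 1 := by omega
    obtain ⟨fσ, hBσ⟩ := card_eq_one.1 hB1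
    have hfσ : fσ ∈ B := hBσ ▸ mem_singleton_self _
    rw [hBdef, mem_filter] at hfσ
    obtain ⟨hfσC, hσa, hσb⟩ := hfσ
    have hc2 : (J₀ \ N).card ≤ 2 := by omega
    -- no other output of the family holds `σ`; in particular path edges are literal edges of `J₀ ∖ N`
    have noσ : ∀ g ∈ J₀, g ≠ fσ → σ ∉ andPair I g := fun g hg hne h =>
      not_mem_bdry_of_two I (subset_union_left (mem_sdiff.1 hfσC).1) (subset_union_left hg) hne.symm
        (andPair_subset_varSet I fσ hσa) (andPair_subset_varSet I g h) hσb
    have noΛ : ∀ e ∈ N, ∀ g ∈ N, Λ e ∉ andPair I g := fun e he g hg => lambda_not_mem hG he hg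
    -- every certified chord has XOR pair `ends (J₀ ∖ N)`
    have hends : ∀ e ∈ N, xorPair I e = ends I (J₀ \ N) := by
      intro e he
      obtain ⟨ℓ, hℓ2, f, vtx, hf, hv0, hvℓ, hinj, hfinj⟩ := path_data hI hS hG he
      have hfC : ∀ i < ℓ, f i ∈ J₀ \ N := by
        intro i hi
        obtain ⟨hfJ, hl, -⟩ := hf i hi
        refine mem_sdiff.2 ⟨hfJ, fun hfN => ?_⟩
        rcases mem_andPair_of_litEdge I hl with h | h
        · exact noσ (f i) hfJ (fun heq => (mem_sdiff.1 hfσC).2 (heq ▸ hfN)) h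
        · exact noΛ e he (f i) hfN h
      -- the path has at most `#(J₀ ∖ N) ≤ 2` edges
      have hℓle : ℓ ≤ (J₀ \ N).card := by
        have := card_le_card_of_injOn f (fun i hi => hfC i (mem_range.1 hi))
          (fun i hi j hj h => hfinj i (mem_range.1 hi) j (mem_range.1 hj) h)
        rwa [card_range] at this
      have hℓ : ℓ = 2 := by omega
      subst hℓ
      have hne : f 0 ≠ f 1 := fun h => by have := hfinj 0 (by omega) 1 (by omega) h; omega
      have hCeq : J₀ \ N = {f 0, f 1} := by
        symm
        apply eq_of_subset_of_card_le
        · intro g hg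
          rw [mem_insert, mem_singleton] at hg
          rcases hg with rfl | rfl
          · exact hfC 0 (by omega)
          · exact hfC 1 (by omega)
        · rw [card_pair hne]; exact hc2
      obtain ⟨-, -, hx0⟩ := hf 0 (by omega)
      obtain ⟨-, -, hx1⟩ := hf 1 (by omega)
      rw [ends_eq I hCeq hne hx0 hx1 (fun h => absurd (hinj 0 (by omega) 1 (by omega) h) (by omega))
        (fun h => absurd (hinj 1 (by omega) 2 (by omega) h) (by omega))
        (fun h => absurd (hinj 0 (by omega) 2 (by omega) h) (by omega))]
      unfold xorPair
      rw [← hv0, ← hvℓ]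
    have hN1 : N.card ≤ 1 := card_le_one.2 fun e he e' he' =>
      ne_of_xorPair_eq I hI hS ((hends e he).trans (hends e' he').symm)
    omega

end Gate

/-- **GAPTWO-PLAN v1.1 S4c′ — the pin + gate core accounting lemma.** -/
theorem litGateCoreBound : LitGateCoreBound := by
  intro n m r I hI hB hS J₀ N σ Λ ρ hk hx hG
  exact (card_le_three hI hS hB hk hx hG).trans (by norm_num)

end Summit.PneNP.PneNP.Theorems.PstarLitGateCoreProof
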